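import Summits.Ventures.CertifiedManyBodySolver.Downfold.EmeryReadingSeam
import HarnessLib

/-!
# `emeryBoxSLCOClassBareE` — THE S2-CONSUMABLE six-box of #37's CLASS companion after ruling R-dx («MACE members fl OF RECORD;
# `emeryBoxSLCOClass`: print TWO rows — fl [2.10, 2.62] and bare-e V@MF image [0.63, 1.43]; S2's decorated model consumes the bare-e
# row»): the by-member bare-electron image box, its doors, and its place between the printed box and the sound fl-enclosure

Venture CertifiedManyBodySolver, cell `pub/hubbard-downfold` (stage S1 = ROUTER), seat hubbard-downfold-mod-4 (S1/S2 Emery seam);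
namespace `Summit.Ventures.CertifiedManyBodySolver.Downfold`. Sequel of `EmeryBoxesInfiniteLayer` (`emeryBoxSLCOClass`, the PRINTED
CLASS rows: Δ_pd [2.10, 2.62] = Morée 2022 Tab. IV ΔE_xp AE δ0 2.62 / PP δ0 2.36 / PP δ0.1 2.10, now tagged fl@(n̄_x, n̄_p) OF RECORD) and
`EmeryReadingSeam` (`flImage`, `emeryBoxSLCOClassFl` = the SOUND product-box enclosure [0.01, 1.88] of the fl image, `flImage_mem_update`).
RULINGS (cell bus 2026-08-27T11:07–11:18Z): mod-3 A.14b printed the verdict in both readings (fl reproduces the printed LRFB/pinning shifts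
within ±0.5 eV on 8 Hg/Ca/Bi MACE sets, sic misses by |t_SIC| = 1.5–2.1 eV; La₂CuO₄ AE the one exception); lead R-dx ADOPTED «fl OF
RECORD (8 : 1)»; lit-1 withdrew its sic registration for Hg/Ca/Bi. Hence the object S2's decorated model must bind for #37 is the
BARE-ELECTRON (V at mean field) image of the three members: Δ^e = PictureMap.deltaE(Δ, U_x, U_p, 0, n̄_x, n̄_p) = 1.43 (AE) / 0.88 (PP) /
0.63 (PP δ0.1) (mod-3 SrLaCuO2.md §REDUCTION-A v0; A.14 (5b)) ⇒ by-member hull **[0.63, 1.43]** (router/EMERY-LINE-ROWS v1.8 row «M37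
CLASS bare-e V@MF»), all other entries as printed.

* `slcoClassBareEEmery_Delta` = [63/100, 143/100] (`extrapolated`); `emeryBoxSLCOClassBareE`; `_mem_iff`;
* `emeryBoxSLCOClassBareE_refines_Fl` — the by-member box REFINES the sound enclosure box `emeryBoxSLCOClassFl` ([0.63, 1.43] ⊂ [0.01, 1.88]),
  so every word on the Fl box transfers down (`holdsOn_emeryBoxSLCOClassBareE_of_Fl`); and THE THREE MEMBER IMAGES LAND IN IT:
  `flImage_AE_mem_bareE` / `flImage_PP_mem_bareE` / `flImage_PPd01_mem_bareE` (the fl-images of the three printed member vectors at their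
  own printed occupations are members — exact rational arithmetic: 1.426695, 0.87851, 0.63288);
* doors: `slcoClassBareE_emeryLo/Hi` ([(1.29, 0.74, 0.63, 0, 8.88, 5.76), (1.36, 0.82, 1.43, 0, 9.72, 6.30)]), `_energyWord`, `_energyFloor`
  (64 vertices), `slcoClassBareE_lowerFace` + `_energyFloor_lowerFace` (4 corners (t_pd, t_pp) ∈ {1.29, 1.36} × {0.74, 0.82} at
  (ε_d, ε_p, U_d, U_p) = (0.63, 0, 8.88, 5.76)), `slcoClassBareE_widthBudget` = 118/25 = 4.72, `_energy_sub_le`, `_cellFilling`, `_witness_mem`.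

Everything here is PROVED (0 sorry). HONEST FRAMING: the bare-e row is a DERIVED object (printed fl members through mod-3's exact map at
the printed occupations; numbers as printed by mod-3, hull by me) — CLASS transfer (CaCuO₂ → Sr₀.₉La₀.₁CuO₂) and solver-level provenance
ride on it exactly as on the printed box (grade `extrapolated`); V_pd is at mean field by construction of the decorated model; the
product structure decorrelates (Δ^e, U) — a consumer wanting member-exact pairs uses the three `flImage_*_mem_bareE` vectors; nothing about
the material is certified by typing. VERSION RULE: if the box writer re-prints the members or mod-3 re-prints the images, a NEW def follows.
-/

namespace Summit.Ventures.CertifiedManyBodySolver.Downfold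

open NonemptyInterval Literature.MathematicalPhysics.QuantumLattice

noncomputable section

/-- **The bare-electron (V@MF) `Delta_pd` entry of #37's CLASS companion** — by-member hull of the fl-images: AE 2.62 ↦ 1.43, PP δ0
2.36 ↦ 0.88, PP δ0.1 2.10 ↦ 0.63 (mod-3 `PictureMap.deltaE` at the printed GW occupations; SrLaCuO2.md §REDUCTION-A v0; lead R-dx «bare-e
V@MF image [0.63, 1.43]; S2's decorated model consumes the bare-e row»). [folklore] -/
def slcoClassBareEEmery_Delta : Entry := Entry.ofEnds (63/100) (143/100) (by norm_num) .extrapolated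

/-- **`emeryBoxSLCOClassBareE`** — #37's CLASS six-box in the form S2's decorated model consumes (bare electron levels, V at mean field);
all entries other than `Delta_pd` as `emeryBoxSLCOClass`. [folklore] -/
def emeryBoxSLCOClassBareE : EmeryBox := fun c =>
  match c with
  | .DeltaPd => some slcoClassBareEEmery_Delta
  | .tpd => some slcoClassEmery_tpd
  | .tpp => some slcoClassEmery_tpp
  | .tppP => none
  | .Udd => some slcoClassEmery_Udd
  | .Upp => some slcoClassEmery_Upp
  | .Vpd => some slcoClassEmery_Vpd
  | .nHoles => some slcoEmery_nH

/-- **Membership in `emeryBoxSLCOClassBareE` unfolded.** [folklore] -/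
theorem emeryBoxSLCOClassBareE_mem_iff (p : EmeryCoord → ℝ) :
    emeryBoxSLCOClassBareE.Mem p ↔
      (((63/100) : ℚ) : ℝ) ≤ p .DeltaPd ∧ p .DeltaPd ≤ (((143/100) : ℚ) : ℝ) ∧
      (((129/100) : ℚ) : ℝ) ≤ p .tpd ∧ p .tpd ≤ (((34/25) : ℚ) : ℝ) ∧
      (((37/50) : ℚ) : ℝ) ≤ p .tpp ∧ p .tpp ≤ (((41/50) : ℚ) : ℝ) ∧
      (((222/25) : ℚ) : ℝ) ≤ p .Udd ∧ p .Udd ≤ (((243/25) : ℚ) : ℝ) ∧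
      (((144/25) : ℚ) : ℝ) ≤ p .Upp ∧ p .Upp ≤ (((63/10) : ℚ) : ℝ) ∧
      (((11/5) : ℚ) : ℝ) ≤ p .Vpd ∧ p .Vpd ≤ (((123/50) : ℚ) : ℝ) ∧
      (((9/10) : ℚ) : ℝ) ≤ p .nHoles ∧ p .nHoles ≤ (((9/10) : ℚ) : ℝ) := by
  constructor
  · intro h
    have h0 := (Entry.mem_ofEnds_iff _ _ _ _ _).1 (h .DeltaPd slcoClassBareEEmery_Delta rfl)
    have h1 := (Entry.mem_ofEnds_iff _ _ _ _ _).1 (h .tpd slcoClassEmery_tpd rfl)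
    have h2 := (Entry.mem_ofEnds_iff _ _ _ _ _).1 (h .tpp slcoClassEmery_tpp rfl)
    have h4 := (Entry.mem_ofEnds_iff _ _ _ _ _).1 (h .Udd slcoClassEmery_Udd rfl)
    have h5 := (Entry.mem_ofEnds_iff _ _ _ _ _).1 (h .Upp slcoClassEmery_Upp rfl)
    have h6 := (Entry.mem_ofEnds_iff _ _ _ _ _).1 (h .Vpd slcoClassEmery_Vpd rfl)
    have h7 := (Entry.mem_ofEnds_iff _ _ _ _ _).1 (h .nHoles slcoEmery_nH rfl)
    exact ⟨h0.1, h0.2, h1.1, h1.2, h2.1, h2.2, h4.1, h4.2, h5.1, h5.2, h6.1, h6.2, h7.1, h7.2⟩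
  · rintro ⟨a0, b0, a1, b1, a2, b2, a4, b4, a5, b5, a6, b6, a7, b7⟩ i e hi
    cases i <;> simp only [emeryBoxSLCOClassBareE, Option.some.injEq, reduceCtorEq] at hi <;> subst hi
    · exact (Entry.mem_ofEnds_iff _ _ _ _ _).2 ⟨a0, b0⟩
    · exact (Entry.mem_ofEnds_iff _ _ _ _ _).2 ⟨a1, b1⟩
    · exact (Entry.mem_ofEnds_iff _ _ _ _ _).2 ⟨a2, b2⟩
    · exact (Entry.mem_ofEnds_iff _ _ _ _ _).2 ⟨a4, b4⟩
    · exact (Entry.mem_ofEnds_iff _ _ _ _ _).2 ⟨a5, b5⟩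
    · exact (Entry.mem_ofEnds_iff _ _ _ _ _).2 ⟨a6, b6⟩
    · exact (Entry.mem_ofEnds_iff _ _ _ _ _).2 ⟨a7, b7⟩

/-! ### Between the printed box and the sound enclosure -/

/-- **The by-member bare-e box REFINES the sound fl-enclosure box** `emeryBoxSLCOClassFl` (Δ [0.63, 1.43] ⊂ [0.01, 1.88]; all other
entries identical). [folklore] -/
theorem emeryBoxSLCOClassBareE_refines_Fl : emeryBoxSLCOClassBareE.Refines emeryBoxSLCOClassFl := by
  intro p hp
  rw [emeryBoxSLCOClassBareE_mem_iff] at hp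
  obtain ⟨a0, b0, a1, b1, a2, b2, a4, b4, a5, b5, a6, b6, a7, b7⟩ := hp
  intro i e hi
  cases i <;> simp only [emeryBoxSLCOClassFl, Option.some.injEq, reduceCtorEq] at hi <;> subst hi
  · refine (Entry.mem_ofEnds_iff _ _ _ _ _).2 ⟨?_, ?_⟩
    · exact le_trans (by exact_mod_cast (by norm_num)) a0
    · exact le_trans b0 (by exact_mod_cast (by norm_num))
  · exact (Entry.mem_ofEnds_iff _ _ _ _ _).2 ⟨a1, b1⟩
  · exact (Entry.mem_ofEnds_iff _ _ _ _ _).2 ⟨a2, b2⟩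
  · exact (Entry.mem_ofEnds_iff _ _ _ _ _).2 ⟨a4, b4⟩
  · exact (Entry.mem_ofEnds_iff _ _ _ _ _).2 ⟨a5, b5⟩
  · exact (Entry.mem_ofEnds_iff _ _ _ _ _).2 ⟨a6, b6⟩
  · exact (Entry.mem_ofEnds_iff _ _ _ _ _).2 ⟨a7, b7⟩

/-- Words on the sound fl-enclosure box transfer to the by-member bare-e box. [folklore] -/
theorem holdsOn_emeryBoxSLCOClassBareE_of_Fl {W : (EmeryCoord → ℝ) → Prop} (h : HoldsOn W emeryBoxSLCOClassFl) :
    HoldsOn W emeryBoxSLCOClassBareE := h.of_refines emeryBoxSLCOClassBareE_refines_Fl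

/-- The printed AE δ0 member vector of `emeryBoxSLCOClass` (ΔE_xp 2.62, |t_xp| 1.29, |t_pp| 0.74, U_x 9.33, U_p 6.16, V_xp 2.35; t_pp′ 0;
n_holes 0.9). [folklore] -/
def slcoClassMemberAE : EmeryCoord → ℝ := fun c =>
  match c with
  | .DeltaPd => (((131/50) : ℚ) : ℝ) | .tpd => (((129/100) : ℚ) : ℝ) | .tpp => (((37/50) : ℚ) : ℝ) | .tppP => (((0) : ℚ) : ℝ)
  | .Udd => (((933/100) : ℚ) : ℝ) | .Upp => (((154/25) : ℚ) : ℝ) | .Vpd => (((47/20) : ℚ) : ℝ) | .nHoles => (((9/10) : ℚ) : ℝ)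

/-- The printed PP δ0 member vector (2.36, 1.36, 0.77, 9.72, 6.30, 2.46). [folklore] -/
def slcoClassMemberPP : EmeryCoord → ℝ := fun c =>
  match c with
  | .DeltaPd => (((59/25) : ℚ) : ℝ) | .tpd => (((34/25) : ℚ) : ℝ) | .tpp => (((77/100) : ℚ) : ℝ) | .tppP => (((0) : ℚ) : ℝ)
  | .Udd => (((243/25) : ℚ) : ℝ) | .Upp => (((63/10) : ℚ) : ℝ) | .Vpd => (((123/50) : ℚ) : ℝ) | .nHoles => (((9/10) : ℚ) : ℝ)

/-- The printed PP δ0.1 member vector (2.10, 1.35, 0.82, 8.88, 5.76, 2.20). [folklore] -/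
def slcoClassMemberPPd01 : EmeryCoord → ℝ := fun c =>
  match c with
  | .DeltaPd => (((21/10) : ℚ) : ℝ) | .tpd => (((27/20) : ℚ) : ℝ) | .tpp => (((41/50) : ℚ) : ℝ) | .tppP => (((0) : ℚ) : ℝ)
  | .Udd => (((222/25) : ℚ) : ℝ) | .Upp => (((144/25) : ℚ) : ℝ) | .Vpd => (((11/5) : ℚ) : ℝ) | .nHoles => (((9/10) : ℚ) : ℝ)

/-- **The AE member's fl-image at its printed occupations (n̄_x, n̄_p) = (1.433, 1.783) is a member of the bare-e box**
(Δ^e = 2.62 − (9.33·1.433 − 6.16·1.783)/2 = 1.426695 ∈ [0.63, 1.43]). [folklore] -/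
theorem flImage_AE_mem_bareE : emeryBoxSLCOClassBareE.Mem (flImage (1433/1000) (1783/1000) slcoClassMemberAE) := by
  rw [emeryBoxSLCOClassBareE_mem_iff, flImage_DeltaPd, flImage_of_ne (by decide), flImage_of_ne (by decide),
    flImage_of_ne (by decide), flImage_of_ne (by decide), flImage_of_ne (by decide), flImage_of_ne (by decide)]
  simp only [slcoClassMemberAE]
  push_cast
  norm_num

/-- **The PP δ0 member's fl-image at (1.454, 1.773) is a member** (Δ^e = 0.87851). [folklore] -/
theorem flImage_PP_mem_bareE : emeryBoxSLCOClassBareE.Mem (flImage (727/500) (1773/1000) slcoClassMemberPP) := by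
  rw [emeryBoxSLCOClassBareE_mem_iff, flImage_DeltaPd, flImage_of_ne (by decide), flImage_of_ne (by decide),
    flImage_of_ne (by decide), flImage_of_ne (by decide), flImage_of_ne (by decide), flImage_of_ne (by decide)]
  simp only [slcoClassMemberPP]
  push_cast
  norm_num

/-- **The PP δ0.1 member's fl-image at (1.474, 1.763) is a member** (Δ^e = 0.63288). [folklore] -/
theorem flImage_PPd01_mem_bareE : emeryBoxSLCOClassBareE.Mem (flImage (737/500) (1763/1000) slcoClassMemberPPd01) := by
  rw [emeryBoxSLCOClassBareE_mem_iff, flImage_DeltaPd, flImage_of_ne (by decide), flImage_of_ne (by decide),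
    flImage_of_ne (by decide), flImage_of_ne (by decide), flImage_of_ne (by decide), flImage_of_ne (by decide)]
  simp only [slcoClassMemberPPd01]
  push_cast
  norm_num

/-- The three printed member vectors are members of the PRINTED box `emeryBoxSLCOClass` (so the images above are images OF members).
[folklore] -/
theorem slcoClassMembers_mem :
    emeryBoxSLCOClass.Mem slcoClassMemberAE ∧ emeryBoxSLCOClass.Mem slcoClassMemberPP ∧ emeryBoxSLCOClass.Mem slcoClassMemberPPd01 := by
  refine ⟨?_, ?_, ?_⟩ <;> rw [emeryBoxSLCOClass_mem_iff] <;>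
    simp only [slcoClassMemberAE, slcoClassMemberPP, slcoClassMemberPPd01] <;>
    refine ⟨?_, ?_, ?_, ?_, ?_, ?_, ?_, ?_, ?_, ?_, ?_, ?_, ?_, ?_⟩ <;> exact Rat.cast_le.mpr (by norm_num)

/-! ### Doors of the bare-e box -/

/-- Lower corner of the delivered six-box of `emeryBoxSLCOClassBareE` at `εp = 0`: `(129/100, 37/50, 63/100, 0, 222/25, 144/25)`. [folklore] -/
theorem slcoClassBareE_emeryLo : emeryLo 0 slcoClassEmery_tpd slcoClassEmery_tpp slcoClassBareEEmery_Delta slcoClassEmery_Udd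
    slcoClassEmery_Upp = ![129/100, 37/50, 63/100, 0, 222/25, 144/25] := by
  ext i; fin_cases i <;>
    simp [emeryLo, slcoClassEmery_tpd, slcoClassEmery_tpp, slcoClassBareEEmery_Delta, slcoClassEmery_Udd, slcoClassEmery_Upp]

/-- Upper corner: `(34/25, 41/50, 143/100, 0, 243/25, 63/10)`. [folklore] -/
theorem slcoClassBareE_emeryHi : emeryHi 0 slcoClassEmery_tpd slcoClassEmery_tpp slcoClassBareEEmery_Delta slcoClassEmery_Udd
    slcoClassEmery_Upp = ![34/25, 41/50, 143/100, 0, 243/25, 63/10] := by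
  ext i; fin_cases i <;>
    simp [emeryHi, slcoClassEmery_tpd, slcoClassEmery_tpp, slcoClassBareEEmery_Delta, slcoClassEmery_Udd, slcoClassEmery_Upp]

/-- **S2 box statement ⇒ box word on `emeryBoxSLCOClassBareE`.** [folklore] -/
theorem emeryBoxSLCOClassBareE_energyWord {W : (Fin 6 → ℝ) → Prop}
    (hW : ∀ q ∈ Set.Icc (![129/100, 37/50, 63/100, 0, 222/25, 144/25] : Fin 6 → ℝ) ![34/25, 41/50, 143/100, 0, 243/25, 63/10], W q) :
    HoldsOn (fun p : EmeryCoord → ℝ => W (emeryLineCoords 0 p)) emeryBoxSLCOClassBareE := by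
  have h := holdsOn_of_forall_emeryLineBox (E := emeryBoxSLCOClassBareE) (εp := 0) (eA := slcoClassEmery_tpd)
    (eB := slcoClassEmery_tpp) (eD := slcoClassBareEEmery_Delta) (eUd := slcoClassEmery_Udd) (eUp := slcoClassEmery_Upp)
    rfl rfl rfl rfl rfl (W := W) (by rw [slcoClassBareE_emeryLo, slcoClassBareE_emeryHi]; exact hW)
  simpa using h

/-- **Vertex-certified three-band energy floor on `emeryBoxSLCOClassBareE`** (64 vertices of
`[(129/100, 37/50, 63/100, 0, 222/25, 144/25), (34/25, 41/50, 143/100, 0, 243/25, 63/10)]`). [cite: Israel1979, Thm. I.3.4] -/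
theorem emeryBoxSLCOClassBareE_energyFloor (s : Fin 4 → ℝ) (ρ : ℝ) {m : ℝ}
    (hm : ∀ v ∈ Fintype.piFinset (fun i => ({(![129/100, 37/50, 63/100, 0, 222/25, 144/25] : Fin 6 → ℝ) i,
        (![34/25, 41/50, 143/100, 0, 243/25, 63/10] : Fin 6 → ℝ) i} : Finset ℝ)), m ≤ emeryEnergyDensity (emeryLine s v) ρ) :
    HoldsOn (fun p : EmeryCoord → ℝ => m ≤ emeryEnergyDensity (emeryLine s (emeryLineCoords 0 p)) ρ) emeryBoxSLCOClassBareE := by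
  have h := holdsOn_emeryEnergyFloor (E := emeryBoxSLCOClassBareE) (εp := 0) (eA := slcoClassEmery_tpd) (eB := slcoClassEmery_tpp)
    (eD := slcoClassBareEEmery_Delta) (eUd := slcoClassEmery_Udd) (eUp := slcoClassEmery_Upp) rfl rfl rfl rfl rfl s ρ (m := m)
    (by rw [slcoClassBareE_emeryLo, slcoClassBareE_emeryHi]; exact hm)
  simpa using h

/-- The lower face of the bare-e six-box: `(34/25, 41/50, 63/100, 0, 222/25, 144/25)`. [folklore] -/
theorem slcoClassBareE_lowerFace :
    lowerFace (![129/100, 37/50, 63/100, 0, 222/25, 144/25] : Fin 6 → ℝ) ![34/25, 41/50, 143/100, 0, 243/25, 63/10] =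
      ![34/25, 41/50, 63/100, 0, 222/25, 144/25] := by
  ext i; fin_cases i <;> simp [lowerFace]

/-- **Four corner certificates bind `emeryBoxSLCOClassBareE`**: `(t_pd, t_pp) ∈ {1.29, 1.36} × {0.74, 0.82}` at `ε_d = 0.63, ε_p = 0,
U_d = 8.88, U_p = 5.76`. [cite: Israel1979, Thm. I.3.4] -/
theorem emeryBoxSLCOClassBareE_energyFloor_lowerFace (s : Fin 4 → ℝ) (ρ : ℝ) {m : ℝ}
    (hm : ∀ v ∈ Fintype.piFinset (fun i => ({(![129/100, 37/50, 63/100, 0, 222/25, 144/25] : Fin 6 → ℝ) i,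
        (![34/25, 41/50, 63/100, 0, 222/25, 144/25] : Fin 6 → ℝ) i} : Finset ℝ)), m ≤ emeryEnergyDensity (emeryLine s v) ρ) :
    HoldsOn (fun p : EmeryCoord → ℝ => m ≤ emeryEnergyDensity (emeryLine s (emeryLineCoords 0 p)) ρ) emeryBoxSLCOClassBareE := by
  have h := holdsOn_emeryEnergyFloor_lowerFace (E := emeryBoxSLCOClassBareE) (εp := 0) (eA := slcoClassEmery_tpd)
    (eB := slcoClassEmery_tpp) (eD := slcoClassBareEEmery_Delta) (eUd := slcoClassEmery_Udd) (eUp := slcoClassEmery_Upp)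
    rfl rfl rfl rfl rfl s ρ (m := m) (by rw [slcoClassBareE_emeryLo, slcoClassBareE_emeryHi, slcoClassBareE_lowerFace]; exact hm)
  simpa using h

/-- **Width budget of the bare-e box**: `8·0.07 + 8·0.08 + 2·0.80 + 0.84 + 2·0.54 = 4.72 = 118/25` (the printed box: 4.16; the member-image
map widens Δ from 0.52 to 0.80). [folklore] -/
theorem slcoClassBareE_widthBudget :
    8 * slcoClassEmery_tpd.widthR + 8 * slcoClassEmery_tpp.widthR + 2 * slcoClassBareEEmery_Delta.widthR + slcoClassEmery_Udd.widthR +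
        2 * slcoClassEmery_Upp.widthR = ((118/25 : ℚ) : ℝ) := by
  simp only [Entry.widthR, slcoClassEmery_tpd, slcoClassEmery_tpp, slcoClassBareEEmery_Delta, slcoClassEmery_Udd, slcoClassEmery_Upp,
    Entry.encl_ofEnds_fst, Entry.encl_ofEnds_snd]
  push_cast; norm_num

/-- **Two parameter vectors of `emeryBoxSLCOClassBareE` differ in certified three-band energy density by at most `4.72`.**
[cite: Israel1979, Thm. I.3.4] -/
theorem emeryBoxSLCOClassBareE_energy_sub_le {ρ : ℝ} (hne : (emeryStates ρ).Nonempty) {s : Fin 4 → ℝ} (hs : ∀ i, |s i| ≤ 1)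
    (εp : ℝ) {p p' : EmeryCoord → ℝ} (hp : emeryBoxSLCOClassBareE.Mem p) (hp' : emeryBoxSLCOClassBareE.Mem p') :
    |emeryEnergyDensity (emeryLine s (emeryLineCoords εp p)) ρ -
        emeryEnergyDensity (emeryLine s (emeryLineCoords εp p')) ρ| ≤ ((118/25 : ℚ) : ℝ) := by
  rw [← slcoClassBareE_widthBudget]
  exact abs_emeryEnergyDensity_sub_le_of_mem_emeryLineBox (E := emeryBoxSLCOClassBareE) rfl rfl rfl rfl rfl hne hs εp hp hp'

/-- **Cell filling**: `ρ = 51/40` (as the printed box). [folklore] -/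
theorem emeryBoxSLCOClassBareE_cellFilling {p : EmeryCoord → ℝ} (hp : emeryBoxSLCOClassBareE.Mem p) :
    emeryCellFilling p ∈ Set.Icc ((((6 : ℚ) - 9/10) / 4 : ℚ) : ℝ) ((((6 : ℚ) - 9/10) / 4 : ℚ) : ℝ) := by
  have h := emeryCellFilling_mem_Icc (E := emeryBoxSLCOClassBareE) (eN := slcoEmery_nH) rfl hp
  simpa [slcoEmery_nH] using h

/-- **Non-vacuity witness**: the PP δ0 member's bare-e image rounded (Δ^e 0.88 with its own hoppings and U's). [folklore] -/
theorem emeryBoxSLCOClassBareE_witness_mem :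
    emeryBoxSLCOClassBareE.Mem (fun c => match c with
      | .DeltaPd => (((22/25) : ℚ) : ℝ)
      | .tpd => (((34/25) : ℚ) : ℝ)
      | .tpp => (((77/100) : ℚ) : ℝ)
      | .tppP => (((0) : ℚ) : ℝ)
      | .Udd => (((243/25) : ℚ) : ℝ)
      | .Upp => (((63/10) : ℚ) : ℝ)
      | .Vpd => (((123/50) : ℚ) : ℝ)
      | .nHoles => (((9/10) : ℚ) : ℝ)
      ) := by
  rw [emeryBoxSLCOClassBareE_mem_iff]
  refine ⟨?_, ?_, ?_, ?_, ?_, ?_, ?_, ?_, ?_, ?_, ?_, ?_, ?_, ?_⟩ <;> exact Rat.cast_le.mpr (by norm_num)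

end

end Summit.Ventures.CertifiedManyBodySolver.Downfold
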